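import Summits.PneNP.PneNP.Theorems.PermanentDescentUniformizationUnderCollapse
import Summits.PneNP.PneNP.Theorems.PermanentDescentCollapseMakesPermanentEasyIslandDefs
import Literature.Computability.Complexity.CircuitEval
import Literature.Computability.Complexity.SmallPrimesCRT
import Literature.Computability.Complexity.CodeFPTableKit
import HarnessLib

/-!
# Route PermanentDescent, crux `CollapseMakesPermanentEasy` (stmt-PneNP-16142), line `Sketch`
# (idea `errorless-islands`): the bridge, part B — good records, `P/poly` plumbing, remaindering, lengths

Facts used by the seam `stub_bridge` of the skeleton `Cruxes/CollapseMakesPermanentEasy/Lines/Sketch.lean`: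

* §1 `permBits_mem_PPoly_of_goodRecs`: if every side `n` has a GOOD record (`GoodRec`: its value at every
  0/1 word of side `n` is the permanent) of polynomial code length, and the advice-taking decider
  `decideX` is polynomial time on codes (Stub VF), then `PermBits ∈ P/poly` — through
  `P/poly = P + poly advice` (`PPoly_eq_polyAdvice_P_holds`) with advice at length `ℓ` = the records of
  sides `0, …, ℓ`, and `PermCert.mem_PermBits_iff_wfB`;
* §2 tables: every side has a good record by an exhaustive value table (`exists_goodRec_table`; used for
  the finitely many small sides);
* §3 Chinese remaindering with the idempotents `SmallPrimes.crtT S p 1` (`crt_recombine`) and crude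
  polynomial bounds on numeral / raw-list code lengths (`length_natE_le_pow`, `length_rawE_natE_le_pow`).

Sources: S. Arora, B. Barak, *Computational Complexity* (2009), Thm. 6.18, §8.6.2; J. von zur Gathen,
J. Gerhard, *Modern Computer Algebra* (2013), §5.4 (Chinese remaindering).
-/

set_option linter.dupNamespace false -- `Summit.PneNP.PneNP.…`: summit = sub-problem name (D-0017 single-conjunct layout)

namespace Summit.PneNP.PneNP.Theorems.PermIsland

open _root_.Computability Polynomial
open Literature.Computability.Complexity Literature.Computability.Complexity.Brick
  Literature.Computability.Complexity.CodeFP Literature.Computability.Complexity.ModArith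
open Summit.PneNP.PneNP.Theorems.PermCert

/-! ### §1 From good records of polynomial length to `P/poly` -/

/-- The decider agrees with `PermBits` on a query whose side record is good. [folklore] -/
theorem decideX_eq_true_iff {χ : List Bool → Bool} {A : List SRec} {x : List Bool}
    (hA : ∀ n, n ≤ x.length → GoodRec χ n (A.getD n defaultRec)) :
    decideX χ A x = true ↔ x ∈ PermBits := by
  rw [mem_PermBits_iff_wfB]
  unfold decideX
  rw [Bool.and_eq_true]
  constructor
  · rintro ⟨hwf, hbit⟩
    refine ⟨hwf, ?_⟩
    have hwf' := hwf
    simp only [wfB, decide_eq_true_eq] at hwf'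
    have hn : Nat.sqrt (fstF x).length ≤ x.length := by
      have := length_fstF_sndF_le x
      exact (Nat.sqrt_le_self _).trans (by omega)
    rwa [hA _ hn (fstF x) hwf'.2.symm] at hbit
  · rintro ⟨hwf, hbit⟩
    refine ⟨hwf, ?_⟩
    have hwf' := hwf
    simp only [wfB, decide_eq_true_eq] at hwf'
    have hn : Nat.sqrt (fstF x).length ≤ x.length := by
      have := length_fstF_sndF_le x
      exact (Nat.sqrt_le_self _).trans (by omega)
    rwa [hA _ hn (fstF x) hwf'.2.symm]

/-- **`P/poly` from good records**: if every side `n` has a good record of polynomial code length and the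
advice-taking decider is polynomial time on codes, then `PermBits ∈ P/poly` (`P/poly = P` with polynomial
advice; advice at length `ℓ` = the records of sides `0, …, ℓ`). [cite: AroraBarakCC2009, Thm. 6.18] -/
theorem permBits_mem_PPoly_of_goodRecs (χ : List Bool → Bool)
    (hdec : CodeFP (pairE strE (rawE srE)) bitE (fun t => decideX χ t.2 t.1))
    (hgood : ∃ q : Polynomial ℕ, ∀ n, ∃ r : SRec, GoodRec χ n r ∧ (srE r).length ≤ q.eval n) :
    PermBits ∈ PPoly := by
  obtain ⟨q, hq⟩ := hgood
  choose R hR using hq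
  -- the decider as a total string predicate
  obtain ⟨F, hF, hFdec⟩ := hdec
  have hFC : CodeFP strE strE F := of_fn F hF fun _ => rfl
  have hpred : CodeFP strE bitE (fun z => decide (F z = [true])) :=
    (CodeFP.eq (eα := strE) fun _ _ h => h).comp (hFC.pair (const strE [true]))
  set L' : Language Bool := {z | decide (F z = [true]) = true} with hL'
  have hL'P : L' ∈ Classes.P := Literature.Computability.Complexity.LFKN.setOf_codeFP_mem_P hpred
  -- the advice
  set a : ℕ → List Bool := fun ℓ => rawE srE ((List.range (ℓ + 1)).map R) with ha
  rw [show PPoly = polyAdvice Classes.P from PPoly_eq_polyAdvice_P_holds]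
  refine ⟨L', hL'P, a, (X + 1) * (2 * q + 2), fun ℓ => ?_, fun x => ?_⟩
  · -- advice length
    rw [ha]
    simp only [length_rawE, List.map_map, eval_mul, eval_add, eval_X, eval_one, eval_ofNat]
    have key : ∀ n ∈ List.range (ℓ + 1), ((fun r : SRec => 2 * (srE r).length + 2) ∘ R) n ≤ 2 * q.eval ℓ + 2 := by
      intro n hn
      have h1 := (hR n).2
      have h2 : q.eval n ≤ q.eval ℓ := TM2Iter.eval_mono q (by have := List.mem_range.1 hn; omega)
      simp only [Function.comp_apply]
      omega
    calc (List.map ((fun r : SRec => 2 * (srE r).length + 2) ∘ R) (List.range (ℓ + 1))).sum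
        ≤ (List.map (fun _ => 2 * q.eval ℓ + 2) (List.range (ℓ + 1))).sum := List.sum_le_sum key
      _ = (ℓ + 1) * (2 * q.eval ℓ + 2) := by
        rw [List.map_const', List.sum_replicate, List.length_range, smul_eq_mul]
  · -- correctness
    have hz : boolPair x (a x.length) = pairE strE (rawE srE) (x, (List.range (x.length + 1)).map R) := rfl
    rw [hz]
    change x ∈ PermBits ↔ decide (F (pairE strE (rawE srE) (x, (List.range (x.length + 1)).map R)) = [true]) = true
    rw [hFdec, decide_eq_true_iff]
    change x ∈ PermBits ↔ bitE (decideX χ ((List.range (x.length + 1)).map R) x) = [true]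
    rw [show ∀ b : Bool, (bitE b = [true] ↔ b = true) from fun b => by cases b <;> simp [bitE]]
    rw [decideX_eq_true_iff]
    intro n hn
    rw [List.getD_eq_getElem _ _ (by simpa using Nat.lt_succ_of_le hn)]
    simp only [List.getElem_map, List.getElem_range]
    exact (hR n).1


/-! ### §2 Good records for small sides: value tables -/

/-- Every length has an exhaustive word list. [folklore] -/
theorem exists_words_of_length (k : ℕ) : ∃ ws : List (List Bool), ∀ s : List Bool, s.length = k → s ∈ ws := by
  induction k with
  | zero => exact ⟨[[]], fun s hs => by rw [List.length_eq_zero_iff.1 hs]; simp⟩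
  | succ k ih =>
    obtain ⟨ws, hws⟩ := ih
    refine ⟨ws.flatMap fun w => [false :: w, true :: w], fun s hs => ?_⟩
    cases s with
    | nil => simp at hs
    | cons b s' =>
      rw [List.length_cons, Nat.succ_inj] at hs
      rw [List.mem_flatMap]
      refine ⟨s', hws s' hs, ?_⟩
      cases b <;> simp

/-- **A value table for the words of a given length**: `tabVal` returns `v s` at every word `s` of
length `k`. [folklore] -/
theorem exists_tab (v : List Bool → ℕ) (k : ℕ) :
    ∃ tab : List (List Bool × ℕ), ∀ s : List Bool, s.length = k → tabVal tab s = some (v s) := by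
  obtain ⟨ws, hws⟩ := exists_words_of_length k
  refine ⟨ws.map fun w => (w, v w), fun s hs => ?_⟩
  have hmem := hws s hs
  unfold tabVal
  rw [List.find?_map]
  have hsome : (ws.find? ((fun q : List Bool × ℕ => decide (q.1 = s)) ∘ fun w => (w, v w))).isSome = true := by
    rw [List.find?_isSome]
    exact ⟨s, hmem, by simp⟩
  obtain ⟨w, hw⟩ := Option.isSome_iff_exists.1 hsome
  have hws' : w = s := by
    have := List.find?_some hw
    simpa using this
  rw [hw, hws']
  rfl

/-- **Good records for every side, by tables** (used for the finitely many small sides). [folklore] -/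
theorem exists_goodRec_table (χ : List Bool → Bool) (n : ℕ) : ∃ r : SRec, GoodRec χ n r := by
  obtain ⟨tab, htab⟩ := exists_tab (permWord n) (n * n)
  refine ⟨(0, tab, []), fun s hs => ?_⟩
  unfold valR
  rw [show ((0, tab, ([] : List PRec)) : SRec).2.1 = tab from rfl, htab s hs]
  rfl

/-! #### Chinese remaindering with the advice idempotents -/

/-- **Recombination**: with the idempotents `crtT S p 1` of `SmallPrimesCRT`, the residues of `E < ∏ S`
recombine to `E`. [cite: AroraBarakCC2009, §8.6.2] -/
theorem crt_recombine (S : Finset ℕ) (hS : ∀ p ∈ S, p.Prime) {E : ℕ} (hE : E < SmallPrimes.crtM S)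
    (l : List ℕ) (hl : l.Nodup) (hlS : l.toFinset = S) (res : ℕ → ℕ) (hres : ∀ p ∈ S, res p = E % p) :
    sumM (SmallPrimes.crtM S) (l.map fun p => mulM (SmallPrimes.crtM S) (res p) (SmallPrimes.crtT S p 1)) = E := by
  set N := SmallPrimes.crtM S with hN
  rw [sumM_eq, ← List.sum_toFinset _ hl, hlS]
  have h1 : (∑ p ∈ S, mulM N (res p) (SmallPrimes.crtT S p 1)) % N = (∑ p ∈ S, SmallPrimes.crtT S p (E % p)) % N := by
    rw [Finset.sum_nat_mod, Finset.sum_nat_mod (f := fun p => SmallPrimes.crtT S p (E % p))]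
    congr 1
    refine Finset.sum_congr rfl fun p hp => ?_
    rw [hres p hp, mulM, Nat.mod_mod]
    unfold SmallPrimes.crtT
    rw [Nat.mod_mod, one_mul, Nat.mul_mod, Nat.mod_mod, ← Nat.mul_mod]
  rw [h1]
  have h2 := SmallPrimes.crtSum_mod (S := S) hS E
  unfold SmallPrimes.crtSum at h2
  rw [h2, Nat.mod_eq_of_lt hE]

/-! #### Numeral and list-code length bounds -/

/-- `K < 2^K`, `K ≤ K^7`, and friends: monomial domination for `K ≥ 1`. [folklore] -/
theorem pow_le_pow_seven {K : ℕ} (hK : 1 ≤ K) {j : ℕ} (hj : j ≤ 7) : K ^ j ≤ K ^ 7 :=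
  Nat.pow_le_pow_right hK hj

/-- A numeral below `2^(K·K)` has length `≤ K^7` (for `K ≥ 1`). [folklore] -/
theorem length_natE_le_pow {K x : ℕ} (hK : 1 ≤ K) (hx : x < 2 ^ (K * K)) : (natE x).length ≤ K ^ 7 :=
  (length_natE_le_of_lt hx).trans (by rw [← pow_two]; exact pow_le_pow_seven hK (by norm_num))

/-- A raw list of `≤ K` numerals below `2^(K·K)` has code length `≤ K^7` (for `K ≥ 2`). [folklore] -/
theorem length_rawE_natE_le_pow {K : ℕ} (hK : 2 ≤ K) {l : List ℕ} (hl : l.length ≤ K) (hx : ∀ x ∈ l, x < 2 ^ (K * K)) :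
    (rawE natE l).length ≤ K ^ 7 := by
  have h1 : (rawE natE l).length ≤ l.length * (2 * (K * K) + 2) :=
    length_rawE_le_of_forall fun a ha => length_natE_le_of_lt (hx a ha)
  have h2 : l.length * (2 * (K * K) + 2) ≤ K * (2 * (K * K) + 2) := Nat.mul_le_mul_right _ hl
  have h3 : K * (2 * (K * K) + 2) ≤ K ^ 7 := by
    have hK4 : 4 ≤ K ^ 2 := by nlinarith
    have : K * (2 * (K * K) + 2) = 2 * K ^ 3 + 2 * K := by ring
    rw [this]
    calc 2 * K ^ 3 + 2 * K ≤ 2 * K ^ 3 + 2 * K ^ 3 := by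
            have := pow_le_pow_seven (K := K) (by omega) (j := 1) (by norm_num)
            nlinarith [Nat.pow_le_pow_right (show 1 ≤ K by omega) (show 1 ≤ 3 by norm_num)]
      _ = 4 * K ^ 3 := by ring
      _ ≤ K ^ 2 * K ^ 3 := Nat.mul_le_mul_right _ hK4
      _ ≤ K ^ 7 := by rw [← pow_add]; exact pow_le_pow_seven (by omega) (by norm_num)
  exact h1.trans (h2.trans h3)


end Summit.PneNP.PneNP.Theorems.PermIsland
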